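/-
Copyright (c) 2026. All rights reserved.
Released under Apache 2.0 license as described in the file LICENSE.
Authors: abc-iut cell, fact-proving seat abc-iut-f-074 (block F, tranche 74; FACT-LIST rows F-0326,
F-0333 of abc-iut-L4-t9's `BiAnabelianTelecore.lean`, instance forms).
-/
import Literature.AnabelianGeometry.AbsoluteAnabelian.AbsTopIII.BiAnabelianTelecoreIncompatibilityIff
import Literature.AnabelianGeometry.AbsoluteAnabelian.AbsTopIII.BiAnabelianTelecoreIncompatibilityInstances
import Literature.AnabelianGeometry.AbsoluteAnabelian.AbsTopIII.MonoAnabelianComparisonPredicatesProofs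

/-!
# [AbsTopIII] Corollary 3.7 (iv) at the model of MLF-Galois pairs: FACT-LIST instance forms

S. Mochizuki, *Topics in absolute anabelian geometry III* [MochizukiAbsTopIII2015] (kurims manuscript
`paper:url-5493eb38cbb7`), Cor 3.7 (iv) p. 88; Lemma 3.4 p. 74.

PROOF-ONLY companion of `BiAnabelianTelecore.lean` (abc-iut-L4-t9).  The FACT-LIST rows F-0333
(`TelecoreIncompatibleStmt`) and F-0326 (`Cor_3_7_iv`) are schemata over an abstract setting whose
universal closures are false (`BiAnabelianTelecoreSchemaNegative.lean`); by the exact criterion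
(`telecoreIncompatibleStmt_iff`, `BiAnabelianTelecoreIncompatibilityIff.lean`) they hold precisely
where `ι_×` is not `ι_log` transported along `ℓ = logIsoId`.  Here: the named instances — the
`P`-sub-models of abc-iut-L4-t9's model of MLF-Galois `TF`-pairs on `ℚ̄_p` containing an object, for
every bi-anabelian lift datum (abc-iut-f-074 gen 0's `model_of_telecoreIncompatibleStmt` /
`model_of_cor_3_7_iv`, Lemma 3.4 at that object) — restated under the `_holds` names of the FACT-LIST
convention where new (`telecoreIncompatibleStmt_holds` at the bare model, via the exact criterion
and `¬ LogCoreKernel` there), together with the CONCRETE defect the criterion isolates at the model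
(`exists_iotaLog_ne_iotaTimes`, `exists_iotaLog_ne_iotaTimes_restrict`).  Nothing here bears on [IUTchIII] Cor. 3.12; no side taken; typed ≠
proved except for the theorems of this file.
-/

set_option autoImplicit false

noncomputable section

namespace Literature.AnabelianGeometry.AbsoluteAnabelian

open CategoryTheory

universe u

/-! ## At the sub-models of the model of MLF-Galois pairs (FACT-LIST rows F-0333, F-0326) -/

namespace AbsTopIII.TFModel

variable (p : ℕ) [Fact p.Prime] (P : ObjectProperty (TFModel p))

/-- **INSTANCE FORM of FACT-LIST row F-0333 (`TelecoreIncompatibleStmt`) at the named instance**: the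
typed second incompatibility of Cor 3.7 (iv) holds at abc-iut-L4-t9's model of MLF-Galois `TF`-pairs on
`ℚ̄_p`, for EVERY bi-anabelian lift datum — by the exact criterion, because at the mono-analytic pair
over `ℚ_p` Lemma 3.4 forbids `λ^×(a) ≫ ι_log = ι_×` for every isomorphism `a`, in particular for
`ℓ⁻¹` (`modelSetting_logKernelObstruction`).  (Universal closure over all settings false:
`not_forall_telecoreIncompatibleStmt`; the `P`-sub-model forms are abc-iut-f-074 gen 0's
`model_of_telecoreIncompatibleStmt`, and `model_cor_3_7_iv` is the row F-0326 at this instance.)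
[cite: MochizukiAbsTopIII2015, Cor 3.7 (iv) p.88] -/
theorem telecoreIncompatibleStmt_holds (θ : FiberSquare.BiAnabelianLift (modelSetting p).gal) :
    Literature.AnabelianGeometry.AbsoluteAnabelian.AbsTopIII.BiAnabelianSetting.TelecoreIncompatibleStmt
      (modelSetting p) θ :=
  (modelSetting p).telecoreIncompatibleStmt_of_not_logCoreKernel θ
    ((modelSetting p).not_logCoreKernel_of_logKernelObstruction (modelSetting_logKernelObstruction p))

/-- At the model the criterion is met CONCRETELY: at some MLF-Galois pair `A`,
`λ^×(ℓ_A⁻¹) ≫ ι_{log,A} ≠ ι_{×,A}` (Lemma 3.4 through `telecoreIncompatibleStmt_iff`).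
[cite: MochizukiAbsTopIII2015, Lemma 3.4 p.74] -/
theorem exists_iotaLog_ne_iotaTimes (θ : FiberSquare.BiAnabelianLift (modelSetting p).gal) :
    ∃ A, (modelSetting p).lamTimes.map ((modelSetting p).logIsoId.inv.app A) ≫
      (modelSetting p).iotaLog.app A ≠ (modelSetting p).iotaTimes.app A :=
  ((modelSetting p).telecoreIncompatibleStmt_iff θ).1 (telecoreIncompatibleStmt_holds p θ)

/-- The same at every `P`-sub-model containing an object (abc-iut-f-074 gen 0's
`model_of_telecoreIncompatibleStmt` through the criterion). [cite: MochizukiAbsTopIII2015, Lemma 3.4 p.74] -/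
theorem exists_iotaLog_ne_iotaTimes_restrict (x₀ : TFModel p) (hx₀ : P x₀)
    (θ : FiberSquare.BiAnabelianLift ((modelSetting p).restrict P fun _ h => h).gal) :
    ∃ A, ((modelSetting p).restrict P fun _ h => h).lamTimes.map
        (((modelSetting p).restrict P fun _ h => h).logIsoId.inv.app A) ≫
      ((modelSetting p).restrict P fun _ h => h).iotaLog.app A ≠
      ((modelSetting p).restrict P fun _ h => h).iotaTimes.app A :=
  (((modelSetting p).restrict P fun _ h => h).telecoreIncompatibleStmt_iff θ).1
    (model_of_telecoreIncompatibleStmt p P x₀ hx₀ θ)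

end AbsTopIII.TFModel

end Literature.AnabelianGeometry.AbsoluteAnabelian

end
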